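import Mathlib
import Summits.CriticalPhenomena.CardyFormulaZ2.Theorems.CardySelfRefinementDefs
import Summits.CriticalPhenomena.CardyFormulaZ2.Theorems.CardySelfRefinementRussoDriftModel
import Summits.CriticalPhenomena.CardyFormulaZ2.Theorems.CardySelfRefinementGradientComparabilityStubDrhoEqSignedSum
import Summits.CriticalPhenomena.CardyFormulaZ2.Theorems.CardySelfRefinementGradientComparabilityStubBoundaryValuesHi
import Summits.CriticalPhenomena.CardyFormulaZ2.Theorems.CardySelfRefinementGradientComparabilityStubDcZeroHalfGeSumPivotal
import Summits.CriticalPhenomena.CardyFormulaZ2.Theorems.CardySelfRefinementCriticalPathRSWStubCone2Sections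
import Summits.CriticalPhenomena.CardyFormulaZ2.Theorems.CardySelfRefinementCriticalPathRSWStubCone2Russo
import Literature.Probability.Percolation.SelfRefinementMeasure
import HarnessLib

/-!
# Crux `GradientComparability` (stmt-CriticalPhenomena-10269), line `monotone-product-coordinates` —
# registered sub-goal `slopeBounds_corner`: the `k = 2` corner dictionary for `∂ρP` (four-term form)

Route `CardySelfRefinement`, sub-problem `CriticalPhenomena/CardyFormulaZ2`; vocabulary from
`CardySelfRefinementDefs` (`cfg`, `prm`, `Aloc`, `coinWindow`, `window`, `P`, `Dρ`).

First step of the sign-coherence input (A″₂) of the local corner slope bound (LOC) (see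
`…StubSlopeBoundsCorner.lean` and the worker report): the selector influence of a bundle of `M_2`,
sectioned at the fair shared coin and at the two fair own coins of the bundle, is a signed
four-term combination of the probabilities of the crossing event read on the REST configuration
(all four bundle coins removed, i.e. both sub-edges closed) with the two sub-edges inserted in the
four possible ways:

* `selectorInfl_two_eq_fourTerm` — for ANY measurable event `X` of bond configurations and any
  product coin law with fair shared coin and fair own coins on the tuple `(u, d)` (`a = 2u`,
  `m = a + e_d`, `b = m + e_d`):
  `P(A^{σ←1}) − P(A^{σ←0}) = ¼ (P B₁₁ − P B₁₀ − P B₀₁ + P B₀₀)`, `A = refinementConfig 2 ⁻¹' X`,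
  `B_xy = {rest ∪ (x ? {a,m}) ∪ (y ? {m,b}) ∈ X}` — steps `e1`, `e2` of the `k = 2` cone
  `Cone2.selector_section_sub_ge` (crux `CriticalPathRSW`), which are generic in `X`;
* `Drho_two_eq_quarter_sum_fourTerm` — hence, by the signed Russo dictionary
  `stub_Drho_eq_signed_sum`, for `η ≠ 0`, `ρ ∈ [0,1]`, any `c`:
  `∂ρP(ρ,c) = Σ_{selector coins (u,d,2) of the coin window} ¼ (P B₁₁ − P B₁₀ − P B₀₁ + P B₀₀)` with
  `X = Aloc m F η` (REGISTERED).  Since `B₀₀ ⊆ B₁₀, B₀₁ ⊆ B₁₁`, the summand is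
  `¼ P(AND) − ¼ P(OR)` (`AND = B₁₁ ∖ (B₁₀ ∪ B₀₁)`, `OR = (B₁₀ ∩ B₀₁) ∖ B₀₀`): the per-bundle
  dictionary of the corner analysis for `k = 2`, valid at every `(ρ, c)` including `ρ = 1`.
* `selectorInfl_two_eq_piv_sub_side`, `Drho_two_eq_quarter_piv_sub_side` — the same in the
  PIVOTAL/SIDEWAYS form used by the corner analysis: for an increasing `X`,
  `P(A^{σ←1}) − P(A^{σ←0}) = ¼ (P(B₁₁ ∖ B₀₀) − P(B₁₀ ∖ B₀₀) − P(B₀₁ ∖ B₀₀))`, i.e.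
  `∂ρP = ¼ N_PIV − ¼ Σ_bundles (P(SIDE₁₀) + P(SIDE₀₁))`: `B₁₁ ∖ B₀₀` = "bundle jointly pivotal",
  `B₁₀ ∖ B₀₀` = "the first sub-edge alone already creates the crossing" (a sideways completion at
  the midpoint), the only NEGATIVE contributions to `∂ρP` for `k = 2`.
-/

noncomputable section

namespace Summit.CriticalPhenomena.CardyFormulaZ2.Theorems.CardySelfRefinement

open scoped Topology
open Filter Set MeasureTheory
open Literature.Probability.LatticeModels Literature.Probability.Percolation
open Literature.Probability.Percolation.QuadCrossing
open Summit.CriticalPhenomena.CardyFormulaZ2.Theses.CardySelfRefinement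
open Summit.CriticalPhenomena.CardyFormulaZ2.Cruxes.CriticalPathRSW.FiniteSizeEnvelope.Cone2

/-! ## The four-term identity for one bundle, generic event -/

-- adapted from `Cone2.selector_section_sub_ge` (…CriticalPathRSWStubCone2Charge.lean), steps e1/e2
/-- **Selector influence of an `M_2` bundle, four-term form.**  For the tuple `(u, d)` (`a = 2u`,
`m = a + e_d`, `b = m + e_d`, tuple coins `T = {selector, shared, own_a, own_m}`), a measurable
event `X` of bond configurations pulled back to the coins (`A = refinementConfig 2 ⁻¹' X`), and any
product law `prodBernoulli p` with fair shared coin and fair own coins on the tuple: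
`P(A^{σ←1}) − P(A^{σ←0}) = ¼ (P B₁₁ − P B₁₀ − P B₀₁ + P B₀₀)`, where `B_xy` asks that the rest
configuration `refinementConfig 2 (ω ∖ T)` with the sub-edge `{a,m}` inserted iff `x = 1` and
`{m,b}` inserted iff `y = 1` lies in `X`.  (With the selector on, the bundle reads the fair shared
coin: `½ P B₁₁ + ½ P B₀₀`; with it off, the two fair own coins: `¼ Σ P B_xy`.) -/
theorem selectorInfl_two_eq_fourTerm (p : Site 2 × Fin 2 × Fin 3 → unitInterval) (u : Site 2) (d : Fin 2)
    {X : Set (BondConfig (Site 2))} (hXm : MeasurableSet X) (hph : (p (u, d, 1) : ℝ) = 1 / 2)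
    (hpo₁ : (p (2 * u, d, 0) : ℝ) = 1 / 2) (hpo₂ : (p (2 * u + Pi.single d 1, d, 0) : ℝ) = 1 / 2) :
    (prodBernoulli p).real {ω | insert (u, d, (2 : Fin 3)) ω ∈ refinementConfig 2 ⁻¹' X} -
        (prodBernoulli p).real {ω | ω \ {(u, d, (2 : Fin 3))} ∈ refinementConfig 2 ⁻¹' X} =
      1 / 4 * ((prodBernoulli p).real {ω | insert s(2 * u, 2 * u + Pi.single d 1)
          (insert s(2 * u + Pi.single d 1, 2 * u + Pi.single d 1 + Pi.single d 1)
            (refinementConfig 2 (ω \ {(u, d, (2 : Fin 3)), (u, d, (1 : Fin 3)), (2 * u, d, (0 : Fin 3)),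
              (2 * u + Pi.single d 1, d, (0 : Fin 3))}))) ∈ X} -
        (prodBernoulli p).real {ω | insert s(2 * u, 2 * u + Pi.single d 1)
            (refinementConfig 2 (ω \ {(u, d, (2 : Fin 3)), (u, d, (1 : Fin 3)), (2 * u, d, (0 : Fin 3)),
              (2 * u + Pi.single d 1, d, (0 : Fin 3))})) ∈ X} -
        (prodBernoulli p).real {ω | insert s(2 * u + Pi.single d 1, 2 * u + Pi.single d 1 + Pi.single d 1)
            (refinementConfig 2 (ω \ {(u, d, (2 : Fin 3)), (u, d, (1 : Fin 3)), (2 * u, d, (0 : Fin 3)),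
              (2 * u + Pi.single d 1, d, (0 : Fin 3))})) ∈ X} +
        (prodBernoulli p).real {ω | refinementConfig 2 (ω \ {(u, d, (2 : Fin 3)), (u, d, (1 : Fin 3)),
            (2 * u, d, (0 : Fin 3)), (2 * u + Pi.single d 1, d, (0 : Fin 3))}) ∈ X}) := by
  set T : Set (Site 2 × Fin 2 × Fin 3) := {(u, d, (2 : Fin 3)), (u, d, (1 : Fin 3)), (2 * u, d, (0 : Fin 3)),
    (2 * u + Pi.single d 1, d, (0 : Fin 3))} with hT
  have hAm : MeasurableSet (refinementConfig 2 ⁻¹' X) := measurable_refinementConfig 2 hXm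
  have hη : Measurable fun ω : Set (Site 2 × Fin 2 × Fin 3) => refinementConfig 2 (ω \ T) :=
    (measurable_refinementConfig 2).comp (measurable_set_iff.2 fun i => (measurable_set_mem i).and measurable_const)
  set B₁₁ : Set (Set (Site 2 × Fin 2 × Fin 3)) := {ω | insert s(2 * u, 2 * u + Pi.single d 1)
    (insert s(2 * u + Pi.single d 1, 2 * u + Pi.single d 1 + Pi.single d 1) (refinementConfig 2 (ω \ T))) ∈ X}
    with hB₁₁
  set B₁₀ : Set (Set (Site 2 × Fin 2 × Fin 3)) :=
    {ω | insert s(2 * u, 2 * u + Pi.single d 1) (refinementConfig 2 (ω \ T)) ∈ X} with hB₁₀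
  set B₀₁ : Set (Set (Site 2 × Fin 2 × Fin 3)) :=
    {ω | insert s(2 * u + Pi.single d 1, 2 * u + Pi.single d 1 + Pi.single d 1) (refinementConfig 2 (ω \ T)) ∈ X}
    with hB₀₁
  set B₀₀ : Set (Set (Site 2 × Fin 2 × Fin 3)) := {ω | refinementConfig 2 (ω \ T) ∈ X} with hB₀₀
  -- Step 1: the `1`-section at the selector, sectioned at the shared coin
  have e1 : (prodBernoulli p).real {ω | insert (u, d, (2 : Fin 3)) ω ∈ refinementConfig 2 ⁻¹' X} =
      1 / 2 * (prodBernoulli p).real B₁₁ + 1 / 2 * (prodBernoulli p).real B₀₀ := by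
    rw [prodBernoulli_real_eq_sections p (measurableSet_setOf_insert_mem hAm _) (u, d, 1), hph]
    have h1 : {ω : Set (Site 2 × Fin 2 × Fin 3) | insert (u, d, (1 : Fin 3)) ω ∈
        {ω | insert (u, d, (2 : Fin 3)) ω ∈ refinementConfig 2 ⁻¹' X}} = B₁₁ := by
      ext ω
      simp only [Set.mem_setOf_eq, Set.mem_preimage, refinementConfig_insert_selector_insert_shared, hB₁₁, ← hT]
    have h0 : {ω : Set (Site 2 × Fin 2 × Fin 3) | ω \ {(u, d, (1 : Fin 3))} ∈
        {ω | insert (u, d, (2 : Fin 3)) ω ∈ refinementConfig 2 ⁻¹' X}} = B₀₀ := by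
      ext ω
      simp only [Set.mem_setOf_eq, Set.mem_preimage, refinementConfig_insert_selector_sdiff_shared, hB₀₀, ← hT]
    rw [h1, h0]
    norm_num
  -- Step 2: the `0`-section at the selector, sectioned at the two own coins
  have e2 : (prodBernoulli p).real {ω | ω \ {(u, d, (2 : Fin 3))} ∈ refinementConfig 2 ⁻¹' X} =
      1 / 4 * ((prodBernoulli p).real B₁₁ + (prodBernoulli p).real B₁₀ + (prodBernoulli p).real B₀₁ +
        (prodBernoulli p).real B₀₀) := by
    have hF := measurableSet_setOf_sdiff_mem hAm (u, d, (2 : Fin 3))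
    rw [prodBernoulli_real_eq_sections p hF (2 * u, d, 0), hpo₁,
      prodBernoulli_real_eq_sections p (measurableSet_setOf_insert_mem hF _) (2 * u + Pi.single d 1, d, 0), hpo₂,
      prodBernoulli_real_eq_sections p (measurableSet_setOf_sdiff_mem hF _) (2 * u + Pi.single d 1, d, 0), hpo₂]
    have h11 : {ω : Set (Site 2 × Fin 2 × Fin 3) | insert (2 * u + Pi.single d 1, d, (0 : Fin 3)) ω ∈
        {ω | insert (2 * u, d, (0 : Fin 3)) ω ∈ {ω | ω \ {(u, d, (2 : Fin 3))} ∈ refinementConfig 2 ⁻¹' X}}} = B₁₁ := by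
      ext ω
      simp only [Set.mem_setOf_eq, Set.mem_preimage, refinementConfig_insert_own_insert_own_sdiff_selector, hB₁₁, ← hT]
    have h10 : {ω : Set (Site 2 × Fin 2 × Fin 3) | ω \ {(2 * u + Pi.single d 1, d, (0 : Fin 3))} ∈
        {ω | insert (2 * u, d, (0 : Fin 3)) ω ∈ {ω | ω \ {(u, d, (2 : Fin 3))} ∈ refinementConfig 2 ⁻¹' X}}} = B₁₀ := by
      ext ω
      simp only [Set.mem_setOf_eq, Set.mem_preimage, refinementConfig_insert_own_sdiff_own_sdiff_selector, hB₁₀, ← hT]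
    have h01 : {ω : Set (Site 2 × Fin 2 × Fin 3) | insert (2 * u + Pi.single d 1, d, (0 : Fin 3)) ω ∈
        {ω | ω \ {(2 * u, d, (0 : Fin 3))} ∈ {ω | ω \ {(u, d, (2 : Fin 3))} ∈ refinementConfig 2 ⁻¹' X}}} = B₀₁ := by
      ext ω
      simp only [Set.mem_setOf_eq, Set.mem_preimage, refinementConfig_insert_own_sdiff_own_sdiff_selector', hB₀₁, ← hT]
    have h00 : {ω : Set (Site 2 × Fin 2 × Fin 3) | ω \ {(2 * u + Pi.single d 1, d, (0 : Fin 3))} ∈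
        {ω | ω \ {(2 * u, d, (0 : Fin 3))} ∈ {ω | ω \ {(u, d, (2 : Fin 3))} ∈ refinementConfig 2 ⁻¹' X}}} = B₀₀ := by
      ext ω
      simp only [Set.mem_setOf_eq, Set.mem_preimage, refinementConfig_sdiff_own_sdiff_own_sdiff_selector, hB₀₀, ← hT]
    rw [h11, h10, h01, h00]
    ring
  rw [e1, e2]
  ring

/-! ## The pivotal/sideways form for an increasing event -/

/-- **Selector influence of an `M_2` bundle, pivotal/sideways form.**  For an INCREASING measurable
event `X` (notation of `selectorInfl_two_eq_fourTerm`; `B₀₀ ⊆ B₁₀, B₀₁ ⊆ B₁₁`):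
`P(A^{σ←1}) − P(A^{σ←0}) = ¼ (P(B₁₁ ∖ B₀₀) − P(B₁₀ ∖ B₀₀) − P(B₀₁ ∖ B₀₀))` — a quarter of the
probability that the bundle is jointly pivotal on the rest configuration, minus a quarter of the
probabilities that one sub-edge alone already creates the event. -/
theorem selectorInfl_two_eq_piv_sub_side (p : Site 2 × Fin 2 × Fin 3 → unitInterval) (u : Site 2) (d : Fin 2)
    {X : Set (BondConfig (Site 2))} (hXm : MeasurableSet X) (hXu : IsUpperSet X)
    (hph : (p (u, d, 1) : ℝ) = 1 / 2) (hpo₁ : (p (2 * u, d, 0) : ℝ) = 1 / 2)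
    (hpo₂ : (p (2 * u + Pi.single d 1, d, 0) : ℝ) = 1 / 2) :
    (prodBernoulli p).real {ω | insert (u, d, (2 : Fin 3)) ω ∈ refinementConfig 2 ⁻¹' X} -
        (prodBernoulli p).real {ω | ω \ {(u, d, (2 : Fin 3))} ∈ refinementConfig 2 ⁻¹' X} =
      1 / 4 * ((prodBernoulli p).real ({ω | insert s(2 * u, 2 * u + Pi.single d 1)
          (insert s(2 * u + Pi.single d 1, 2 * u + Pi.single d 1 + Pi.single d 1)
            (refinementConfig 2 (ω \ {(u, d, (2 : Fin 3)), (u, d, (1 : Fin 3)), (2 * u, d, (0 : Fin 3)),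
              (2 * u + Pi.single d 1, d, (0 : Fin 3))}))) ∈ X} \
          {ω | refinementConfig 2 (ω \ {(u, d, (2 : Fin 3)), (u, d, (1 : Fin 3)),
            (2 * u, d, (0 : Fin 3)), (2 * u + Pi.single d 1, d, (0 : Fin 3))}) ∈ X}) -
        (prodBernoulli p).real ({ω | insert s(2 * u, 2 * u + Pi.single d 1)
            (refinementConfig 2 (ω \ {(u, d, (2 : Fin 3)), (u, d, (1 : Fin 3)), (2 * u, d, (0 : Fin 3)),
              (2 * u + Pi.single d 1, d, (0 : Fin 3))})) ∈ X} \
          {ω | refinementConfig 2 (ω \ {(u, d, (2 : Fin 3)), (u, d, (1 : Fin 3)),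
            (2 * u, d, (0 : Fin 3)), (2 * u + Pi.single d 1, d, (0 : Fin 3))}) ∈ X}) -
        (prodBernoulli p).real ({ω | insert s(2 * u + Pi.single d 1, 2 * u + Pi.single d 1 + Pi.single d 1)
            (refinementConfig 2 (ω \ {(u, d, (2 : Fin 3)), (u, d, (1 : Fin 3)), (2 * u, d, (0 : Fin 3)),
              (2 * u + Pi.single d 1, d, (0 : Fin 3))})) ∈ X} \
          {ω | refinementConfig 2 (ω \ {(u, d, (2 : Fin 3)), (u, d, (1 : Fin 3)),
            (2 * u, d, (0 : Fin 3)), (2 * u + Pi.single d 1, d, (0 : Fin 3))}) ∈ X})) := by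
  rw [selectorInfl_two_eq_fourTerm p u d hXm hph hpo₁ hpo₂]
  set T : Set (Site 2 × Fin 2 × Fin 3) := {(u, d, (2 : Fin 3)), (u, d, (1 : Fin 3)), (2 * u, d, (0 : Fin 3)),
    (2 * u + Pi.single d 1, d, (0 : Fin 3))} with hT
  have hη : Measurable fun ω : Set (Site 2 × Fin 2 × Fin 3) => refinementConfig 2 (ω \ T) :=
    (measurable_refinementConfig 2).comp (measurable_set_iff.2 fun i => (measurable_set_mem i).and measurable_const)
  have hm00 : MeasurableSet {ω : Set (Site 2 × Fin 2 × Fin 3) | refinementConfig 2 (ω \ T) ∈ X} := hη hXm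
  have h11 : {ω : Set (Site 2 × Fin 2 × Fin 3) | refinementConfig 2 (ω \ T) ∈ X} ⊆
      {ω | insert s(2 * u, 2 * u + Pi.single d 1)
        (insert s(2 * u + Pi.single d 1, 2 * u + Pi.single d 1 + Pi.single d 1) (refinementConfig 2 (ω \ T))) ∈ X} :=
    fun ω hω => hXu ((Set.subset_insert _ _).trans (Set.subset_insert _ _)) hω
  have h10 : {ω : Set (Site 2 × Fin 2 × Fin 3) | refinementConfig 2 (ω \ T) ∈ X} ⊆
      {ω | insert s(2 * u, 2 * u + Pi.single d 1) (refinementConfig 2 (ω \ T)) ∈ X} :=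
    fun ω hω => hXu (Set.subset_insert _ _) hω
  have h01 : {ω : Set (Site 2 × Fin 2 × Fin 3) | refinementConfig 2 (ω \ T) ∈ X} ⊆
      {ω | insert s(2 * u + Pi.single d 1, 2 * u + Pi.single d 1 + Pi.single d 1) (refinementConfig 2 (ω \ T)) ∈ X} :=
    fun ω hω => hXu (Set.subset_insert _ _) hω
  rw [measureReal_sdiff h11 hm00, measureReal_sdiff h10 hm00, measureReal_sdiff h01 hm00]
  ring

/-- **`∂ρP` of `M_2`, pivotal/sideways form** (`k = 2` corner dictionary): for `η ≠ 0`,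
`ρ ∈ [0,1]`, any `c` and the coin Finset `K` of the window,
`Dρ 2 m F η (ρ, c) = Σ_{(u,d,2) ∈ K} ¼ (P(B₁₁ ∖ B₀₀) − P(B₁₀ ∖ B₀₀) − P(B₀₁ ∖ B₀₀))` under
`prodBernoulli (prm 2 ρ c)`, `B_xy` read on the rest configuration `cfg 2 (ω ∖ T)` of the bundle
for the increasing cylinder `Aloc m F η`: a quarter of the expected number of jointly pivotal
bundles minus a quarter of the expected number of (bundle, sub-edge) pairs whose sub-edge alone
already creates the crossing.  `stub_Drho_eq_signed_sum` + `selectorInfl_two_eq_piv_sub_side`. -/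
theorem Drho_two_eq_quarter_piv_sub_side (m : ℕ) (F : Fin m → Quad (Set.univ : Set ℂ)) {η : ℝ}
    (hη : η ≠ 0) {ρ : ℝ} (hρ : ρ ∈ Set.Icc (0 : ℝ) 1) (c : ℝ) (K : Finset (Site 2 × Fin 2 × Fin 3))
    (hK : (↑K : Set (Site 2 × Fin 2 × Fin 3)) = coinWindow 2 (window m F η)) :
    Dρ 2 m F η (ρ, c) = ∑ i ∈ K with i.2.2 = 2, 1 / 4 *
      ((prodBernoulli (prm 2 ρ c)).real ({ω | insert s(2 * i.1, 2 * i.1 + Pi.single i.2.1 1)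
          (insert s(2 * i.1 + Pi.single i.2.1 1, 2 * i.1 + Pi.single i.2.1 1 + Pi.single i.2.1 1)
            (cfg 2 (ω \ {(i.1, i.2.1, (2 : Fin 3)), (i.1, i.2.1, (1 : Fin 3)), (2 * i.1, i.2.1, (0 : Fin 3)),
              (2 * i.1 + Pi.single i.2.1 1, i.2.1, (0 : Fin 3))}))) ∈ Aloc m F η} \
          {ω | cfg 2 (ω \ {(i.1, i.2.1, (2 : Fin 3)), (i.1, i.2.1, (1 : Fin 3)),
            (2 * i.1, i.2.1, (0 : Fin 3)), (2 * i.1 + Pi.single i.2.1 1, i.2.1, (0 : Fin 3))}) ∈ Aloc m F η}) -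
        (prodBernoulli (prm 2 ρ c)).real ({ω | insert s(2 * i.1, 2 * i.1 + Pi.single i.2.1 1)
            (cfg 2 (ω \ {(i.1, i.2.1, (2 : Fin 3)), (i.1, i.2.1, (1 : Fin 3)), (2 * i.1, i.2.1, (0 : Fin 3)),
              (2 * i.1 + Pi.single i.2.1 1, i.2.1, (0 : Fin 3))})) ∈ Aloc m F η} \
          {ω | cfg 2 (ω \ {(i.1, i.2.1, (2 : Fin 3)), (i.1, i.2.1, (1 : Fin 3)),
            (2 * i.1, i.2.1, (0 : Fin 3)), (2 * i.1 + Pi.single i.2.1 1, i.2.1, (0 : Fin 3))}) ∈ Aloc m F η}) -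
        (prodBernoulli (prm 2 ρ c)).real ({ω | insert s(2 * i.1 + Pi.single i.2.1 1,
            2 * i.1 + Pi.single i.2.1 1 + Pi.single i.2.1 1)
            (cfg 2 (ω \ {(i.1, i.2.1, (2 : Fin 3)), (i.1, i.2.1, (1 : Fin 3)), (2 * i.1, i.2.1, (0 : Fin 3)),
              (2 * i.1 + Pi.single i.2.1 1, i.2.1, (0 : Fin 3))})) ∈ Aloc m F η} \
          {ω | cfg 2 (ω \ {(i.1, i.2.1, (2 : Fin 3)), (i.1, i.2.1, (1 : Fin 3)),
            (2 * i.1, i.2.1, (0 : Fin 3)), (2 * i.1 + Pi.single i.2.1 1, i.2.1, (0 : Fin 3))}) ∈ Aloc m F η})) := by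
  rw [stub_Drho_eq_signed_sum 2 m F hη hρ c K hK]
  refine Finset.sum_congr rfl fun i hi => ?_
  rw [Finset.mem_filter] at hi
  obtain ⟨u, d, j⟩ := i
  obtain ⟨-, hj⟩ := hi
  dsimp only at hj
  subst hj
  dsimp only
  have hph : ((prm 2 ρ c) (u, d, 1) : ℝ) = 1 / 2 := by
    rw [prm_eq_refinementParam, refinementParam_apply_one, coe_half]
  have hpo : ∀ e : Site 2 × Fin 2, IsAxialEdge 2 e → ((prm 2 ρ c) (e.1, e.2, 0) : ℝ) = 1 / 2 := fun e he => by
    rw [prm_eq_refinementParam, refinementParam_apply_zero_of_isAxialEdge _ _ he, coe_half]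
  have h := selectorInfl_two_eq_piv_sub_side (prm 2 ρ c) u d (measurableSet_Aloc m F hη)
    (isUpperSet_Aloc m F η) hph (hpo _ (isAxialEdge_two_mul u d).1) (hpo _ (isAxialEdge_two_mul_add_single u d).1)
  rw [← cfg_eq_refinementConfig] at h
  exact h

/-! ## The `k = 2` dictionary for `∂ρP`, four-term form -/

/-- **`∂ρP` of `M_2` as a quarter-sum of four-term bundle differences** (registered helper of the
corner clause `slopeBounds_corner`).  For `η ≠ 0`, `ρ ∈ [0,1]`, any `c`, and the coin Finset `K`
of the window: `Dρ 2 m F η (ρ, c) = Σ_{(u,d,2) ∈ K} ¼ (P B₁₁ − P B₁₀ − P B₀₁ + P B₀₀)` under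
`prodBernoulli (prm 2 ρ c)`, where `B_xy = {ω | rest(ω) ∪ (x ? {2u, 2u+e_d}) ∪ (y ? {2u+e_d, 2u+2e_d})
∈ Aloc m F η}` and `rest(ω) = cfg 2 (ω ∖ {selector, shared, own_{2u}, own_{2u+e_d}})` (both
sub-edges of the bundle closed).  Signed Russo dictionary `stub_Drho_eq_signed_sum` plus the
four-term identity `selectorInfl_two_eq_fourTerm` bundle by bundle (the shared coin and the own
coins of the two axial sub-edges are fair under `prm 2 ρ c`). -/
theorem Drho_two_eq_quarter_sum_fourTerm (m : ℕ) (F : Fin m → Quad (Set.univ : Set ℂ)) {η : ℝ}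
    (hη : η ≠ 0) {ρ : ℝ} (hρ : ρ ∈ Set.Icc (0 : ℝ) 1) (c : ℝ) (K : Finset (Site 2 × Fin 2 × Fin 3))
    (hK : (↑K : Set (Site 2 × Fin 2 × Fin 3)) = coinWindow 2 (window m F η)) :
    Dρ 2 m F η (ρ, c) = ∑ i ∈ K with i.2.2 = 2, 1 / 4 *
      ((prodBernoulli (prm 2 ρ c)).real {ω | insert s(2 * i.1, 2 * i.1 + Pi.single i.2.1 1)
          (insert s(2 * i.1 + Pi.single i.2.1 1, 2 * i.1 + Pi.single i.2.1 1 + Pi.single i.2.1 1)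
            (cfg 2 (ω \ {(i.1, i.2.1, (2 : Fin 3)), (i.1, i.2.1, (1 : Fin 3)), (2 * i.1, i.2.1, (0 : Fin 3)),
              (2 * i.1 + Pi.single i.2.1 1, i.2.1, (0 : Fin 3))}))) ∈ Aloc m F η} -
        (prodBernoulli (prm 2 ρ c)).real {ω | insert s(2 * i.1, 2 * i.1 + Pi.single i.2.1 1)
            (cfg 2 (ω \ {(i.1, i.2.1, (2 : Fin 3)), (i.1, i.2.1, (1 : Fin 3)), (2 * i.1, i.2.1, (0 : Fin 3)),
              (2 * i.1 + Pi.single i.2.1 1, i.2.1, (0 : Fin 3))})) ∈ Aloc m F η} -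
        (prodBernoulli (prm 2 ρ c)).real {ω | insert s(2 * i.1 + Pi.single i.2.1 1,
            2 * i.1 + Pi.single i.2.1 1 + Pi.single i.2.1 1)
            (cfg 2 (ω \ {(i.1, i.2.1, (2 : Fin 3)), (i.1, i.2.1, (1 : Fin 3)), (2 * i.1, i.2.1, (0 : Fin 3)),
              (2 * i.1 + Pi.single i.2.1 1, i.2.1, (0 : Fin 3))})) ∈ Aloc m F η} +
        (prodBernoulli (prm 2 ρ c)).real {ω | cfg 2 (ω \ {(i.1, i.2.1, (2 : Fin 3)), (i.1, i.2.1, (1 : Fin 3)),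
            (2 * i.1, i.2.1, (0 : Fin 3)), (2 * i.1 + Pi.single i.2.1 1, i.2.1, (0 : Fin 3))}) ∈ Aloc m F η}) := by
  rw [stub_Drho_eq_signed_sum 2 m F hη hρ c K hK]
  refine Finset.sum_congr rfl fun i hi => ?_
  rw [Finset.mem_filter] at hi
  obtain ⟨u, d, j⟩ := i
  obtain ⟨-, hj⟩ := hi
  dsimp only at hj
  subst hj
  dsimp only
  have hph : ((prm 2 ρ c) (u, d, 1) : ℝ) = 1 / 2 := by
    rw [prm_eq_refinementParam, refinementParam_apply_one, coe_half]
  have hpo : ∀ e : Site 2 × Fin 2, IsAxialEdge 2 e → ((prm 2 ρ c) (e.1, e.2, 0) : ℝ) = 1 / 2 := fun e he => by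
    rw [prm_eq_refinementParam, refinementParam_apply_zero_of_isAxialEdge _ _ he, coe_half]
  have h := selectorInfl_two_eq_fourTerm (prm 2 ρ c) u d (measurableSet_Aloc m F hη) hph
    (hpo _ (isAxialEdge_two_mul u d).1) (hpo _ (isAxialEdge_two_mul_add_single u d).1)
  rw [← cfg_eq_refinementConfig] at h
  exact h

end Summit.CriticalPhenomena.CardyFormulaZ2.Theorems.CardySelfRefinement

end
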